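import Literature.MathematicalPhysics.QuantumFieldTheory.Balaban1983to89.B6ScalarChartV1L0
import Literature.MathematicalPhysics.QuantumFieldTheory.Balaban1983to89.B6Ineq288MultiLevelTorusL0
/-!
# `Balaban1983to89.B6Dg288ChartV1L0` — LEVEL-0 TWIN (programme G-F3′-L0, director-ym LINE №27 / UV3-NODE §24.5; plan `lit-balaban-r03/G-F3L0-PLAN.md`) of `B6Dg288ChartV1`:
the same declarations, SAME NAMES AND STATEMENTS, for nested families WITH print's region `Λ₀ = T ∖ Ω₁` ADMITTED (structures
`B6MultiLevelBoxOperatorL0.Domains` / `B6MultiLevelTorusOperatorL0.TDomains`: levels `0, …, k`, the level-`0` block a single site, `Q′₀ = id`,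
finite weight `a₀` — print p.225 (2.14) «Σ_{j=0}^k … (Q′₀λ)(x) = λ(x), x ∈ Λ₀», p.229 «taking a sequence (2.1) … smallest possible domains B^j(Λ_j),
and considering the operator Δ_a defined by (2.19), (2.20) for this sequence»).  Every `D`-free object is the lineage's, consumed BY NAME; no existing
module is touched; no fact is minted.  LEVEL-0 JOINT J6 (r03 18:57:18Z): `hasMajorant_Dg_V1` ∕ `_TB` carry the extra binder `1 ≤ k →` right after `(hk : k ≤ m + K)` (fed to `B6Ineq288MultiLevelTorusL0.ineq288_multiLevelTorus_chartShape`); census weights `fun j => aPrinted ℓ 1 (j + 1)` in `rM_range_fix`.  Unit `lit-balaban-p21` (packet S-B owner, S-C tail; p21 gen 27; port tooling by r03 gen 36 / p33 gen 88); B6 fold owner r03; referee ref-4.  THE TWIN'S DOCUMENTATION FOLLOWS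
VERBATIM (its «levels 1 … k» / «Ω₁ = X» sentences describe the twin; here `j` runs from `0` and `Ω₁` may be a proper subset).

# `Balaban1983to89.B6Dg288ChartV1` — [B6] (2.88) p. 238 READ IN THE V1 MODEL: the `hDg` input of the genuine `k`-level (2.136)
# assembly (ROUTE V) — `|(∂P∂*)(b, b′)|`-majorant `c′²(d+1)C₂₈₈·(L^j)^{−2}e^{−δ₂d_T(y,y′)}` for the V1 operator
# `∂(1 − R)∂* = onFun (dE c ∘ (1 − RE (domT hN D hk) c) ∘ dsE c)` over r03's `domT`, FROM p21's torus (2.88)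
# `B6Ineq288MultiLevelTorusL0.ineq288_multiLevelTorus` THROUGH the dictionary `B6ScalarChartV1L0.hasMajorant_Dg_chart`

statement-level skeleton of published theorems with citation tags; proofs where landed; nothing here is a claim about the Yang–Mills mass gap

Source under audit (cell pub-balaban / lit-balaban): T. Bałaban, *Propagators and renormalization transformations for lattice gauge
theories. II*, Commun. Math. Phys. **96** (1984) 223–250 [`Balaban1984PropagatorsII`, "B6"], (2.88) p. 238 [PDF 16] («|(∂P∂*)(x, x′)| ≤
O(1)(L^jη)^{−2}(L^{j′}η)^{−d}e^{−δ₂d(y,y′)}»), (2.17) p. 225 (`P = G′Q′*(Q′G′²Q′*)⁻¹Q′G′`, `R = 1 − P` the orthogonal projection onto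
`Δ′N(Q′)`), (2.91)–(2.93) p. 239 and (2.134) p. 247 (where `∂P∂*` enters the kernels `K_{□,□′}`); held text
`paper:balaban1984-cmp96-propagators-rt-ii` p0016, p0017, p0025.  Unit `lit-balaban-p22` (Phase-2 proof seat p22 gen 19), HOME
`run/shared/lean/pub/lit-balaban/`, free-target protocol G.5-34(d); B6-CLOSURE §5 item 13 (ROUTE V, (d5-b)(iv) «p22's V1↔torus dictionary
(hDg)») of the fold owner r03 (request 2026-08-23T02:32Z, normalisation accepted 03:05Z); torus side by p21 gen 16 (`B6Ineq288MultiLevelTorus`, shapes agreed 03:21Z);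
consumer p38's `B6Ineq2134KFamKLevelTorusL0.h2134_kFam_torus` (slot `hDg`); referee ref-4.

## WHAT THIS FILE CERTIFIES (theorems only; no `def`, no new fact)

For the V1 global torus of r03's `B6GlobalChartV1` (`hN : N0 ℓ M_h k P′ = 2L^{m+K}`, `D : TDomains d ℓ M_h k P′ R`, `hk : k ≤ m + K`):
* `rM_range_fix` — the projection hypotheses (hr)/(hf) of the dictionary for `Rm := rM D = 1 − P` in the `perLapT` form, from p21's
  `rM_range_QB`/`rM_mulVec_dP_of_QB` (stated with `Δ′ = dP D`) through `range_fix_of_mlOpT`;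
* `RE_eq_rM_chart` — THE V1 PROJECTION `R` of Sect. A IS p21's TORUS `1 − P` read through the chart: `RE (domT hN D hk) c f x =
  (rM D *ᵥ (f ∘ boxEquiv⁻¹))(toBox x)` (from `RE_chart` with (hs) `rM_transpose`, (hr) `rM_range_QB`, (hf) `rM_mulVec_dP_of_QB` and
  `range_fix_of_mlOpT`), for `L·M_h`, `P′`, `R` as in p21's file (no largeness needed here);
* **`hasMajorant_Dg_V1`** — ONE `(M₃, δ₂, C)` (p21's (2.88)_T constants, on `d, L` only) BEFORE everything: for all V1 data with `1 ≤ M_h`,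
  `4 ≤ P′_μ`, `2L ≤ R`, `M₃ ≤ L·M_h` and every fine factor `c ≠ 0`,
  `HasMajorant (g := geomT D) (blkV1 hN D) (onFun (dE c ∘ₗ (LinearMap.id − RE (domT hN D hk) c) ∘ₗ dsE c))
     (fun y y′ => c²·(d+1)·C / len y ^ 2 · e^{−δ₂·d_T(y,y′)})` — r03's `hDg` VERBATIM (normalisation of 03:05Z), the entry bound (hB)
  being p21's `ineq288_multiLevelTorus_chartShape` (the matrix `(S_μ − 1)(1 − rM)(S_ν − 1)ᵀ` of `B6ScalarChartV1L0.Dg_single` = `dPd D μ ν`);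
* `hasMajorant_Dg_V1_TB` — the same over B8's `geomTB D` (the literal binder of p38's `h2134_kFam_torus`, `CP := c²(d+1)C`).
Non-vacuity of the joint hypothesis set (hN with odd `L`, `4 ≤ P′`, `2L ≤ R`, `M₃ ≤ L·M_h`, both top levels inhabited):
`B6V1TorusWitnessL0.v1Torus_nonvacuous` (p22 gen 19, in the tree).

HONEST SCOPE.  Lattice units of the global V1 torus (`η = 1`; print's `(L^jη)^{−2}(L^{j′}η)^{−d}` ↦ `(L^j)^{−2}·W(y′)^{−1}`, `W(y′) = (L^{j′})^{d+1}`,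
summed over the `≤ (d+1)W(y′)` bonds of a block by the dictionary); `A = 0`, `m² = 0`, printed weights `a_j = aPrinted ℓ 1`; constants explicit,
`k`/`M_h`-independent, not optimised; the analytic content is p21's (2.88)_T and Sect. A's identification of `R` — this file is the bridge only;
integer torus; nothing on d = 4 or the continuum; NOT summit progress.
-/

namespace Literature.MathematicalPhysics.QuantumFieldTheory.Balaban1983to89.B6Dg288ChartV1L0

open scoped Matrix
open Literature.MathematicalPhysics.QuantumFieldTheory.Balaban1983to89.B4Reflection242 (boxDom)
open Literature.MathematicalPhysics.QuantumFieldTheory.Balaban1983to89.B6MultiLevelBoxOperator (N0 aPrinted)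
open Literature.MathematicalPhysics.QuantumFieldTheory.Balaban1983to89.B6MultiLevelTorusOperator (perLapT mlOpT)
open Literature.MathematicalPhysics.QuantumFieldTheory.Balaban1983to89.B6MultiLevelTorusOperatorL0 (TDomains)
open Literature.MathematicalPhysics.QuantumFieldTheory.Balaban1983to89.B6Geom246MultiLevelBoxL0 (blkOf)
open Literature.MathematicalPhysics.QuantumFieldTheory.Balaban1983to89.B6Geom246MultiLevelTorusL0 (geomT)
open Literature.MathematicalPhysics.QuantumFieldTheory.Balaban1983to89.B6Ineq268MultiLevelBoxL0 (W QB)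
open Literature.MathematicalPhysics.QuantumFieldTheory.Balaban1983to89.B8Ineq192MultiLevelTorusL0 (geomTB geomTB_dist geomTB_len geomT_len)
open Literature.MathematicalPhysics.QuantumFieldTheory.Balaban1983to89.B6RandomWalk (HasMajorant)
open Literature.MathematicalPhysics.QuantumFieldTheory.Balaban1983to89.B6Ineq2133TwoScaleV1 (onFun)
open Literature.MathematicalPhysics.QuantumFieldTheory.Balaban1983to89.B6SectAOperatorsV1 (ScalarSpace dE dsE RE)
open Literature.MathematicalPhysics.QuantumFieldTheory.Balaban1983to89.B6GlobalChartV1 (PV toBox boxEquiv)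
open Literature.MathematicalPhysics.QuantumFieldTheory.Balaban1983to89.B6GlobalChartV1L0 (blkV1 domT)
open Literature.MathematicalPhysics.QuantumFieldTheory.Balaban1983to89.B6ScalarChartV1L0 (RE_chart range_fix_of_mlOpT hasMajorant_Dg_chart)
open Literature.MathematicalPhysics.QuantumFieldTheory.Balaban1983to89.B6Ineq288MultiLevelTorusL0 (rM dP rM_transpose rM_range_QB rM_mulVec_dP_of_QB ineq288_multiLevelTorus_chartShape)

noncomputable section

variable {d ℓ : ℕ} {m K : ℕ} {hd : 1 ≤ d + 1} {hL : Odd (ℓ + 1) ∧ 1 < ℓ + 1}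
variable {Mh k R : ℕ} {P' : Fin (d + 1) → ℕ}

/-! ## §1 The V1 projection `R` is p21's torus `1 − P` through the chart -/

section Projection

variable (hN : ∀ μ, N0 ℓ Mh k P' μ = (PV d ℓ m K hd hL).sitesPerDir 0) (D : TDomains d ℓ Mh k P' R) (hk : k ≤ m + K)

/-- the two projection hypotheses (hr)/(hf) of the dictionary for `Rm := rM D`, in the `perLapT` form, from p21's `rM_range_QB` /
`rM_mulVec_dP_of_QB` (stated with `Δ′ = dP D = mlOpT …`) through `range_fix_of_mlOpT`. [cite: Balaban1984PropagatorsII, (2.17) p.225 («R the orthogonal projection onto Δ′N(Q′)»)] -/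
theorem rM_range_fix (hℓ : 1 ≤ ℓ) (hMh : 1 ≤ Mh) (hP : ∀ μ, 1 ≤ P' μ) :
    (∀ f : ↥(boxDom (N0 ℓ Mh k P')) → ℝ, ∃ lam : ↥(boxDom (N0 ℓ Mh k P')) → ℝ,
        B6Ineq268MultiLevelBoxL0.QB D.toDomains lam = 0 ∧ rM D *ᵥ f = perLapT (N0 ℓ Mh k P') *ᵥ lam) ∧
      (∀ lam : ↥(boxDom (N0 ℓ Mh k P')) → ℝ, QB D.toDomains lam = 0 →
        rM D *ᵥ (perLapT (N0 ℓ Mh k P') *ᵥ lam) = perLapT (N0 ℓ Mh k P') *ᵥ lam) :=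
  range_fix_of_mlOpT D (fun j => aPrinted ℓ 1 (j + 1)) (rM D) (fun f => rM_range_QB D hℓ hMh hP f) (fun _ h => rM_mulVec_dP_of_QB D hℓ hMh hP h)

/-- **THE V1 `R` OF SECT. A IS p21's TORUS `1 − P`** read through the chart `toBox hN`: `(Rf)(x) = ((1 − P)(f ∘ boxEquiv⁻¹))(toBox x)`.
[cite: Balaban1984PropagatorsII, (2.17) p.225] -/
theorem RE_eq_rM_chart (hℓ : 1 ≤ ℓ) (hMh : 1 ≤ Mh) (hP : ∀ μ, 1 ≤ P' μ) {c : ℝ} (hc : c ≠ 0)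
    (f : ScalarSpace (PV d ℓ m K hd hL)) (x : Site (PV d ℓ m K hd hL) 0) :
    RE (B6GlobalChartV1L0.domT hN D hk) c f x = (rM D *ᵥ fun z => f ((boxEquiv hN).symm z)) (toBox hN x) :=
  RE_chart hN D hk hc (rM D) (rM_transpose D hℓ hMh hP) (rM_range_fix D hℓ hMh hP).1 (rM_range_fix D hℓ hMh hP).2 f x

end Projection

/-! ## §2 The `hDg` input of the `k`-level (2.136) assembly -/

section Majorant

open Literature.MathematicalPhysics.QuantumFieldTheory.Balaban1983to89

/-- **[B6] (2.88) FOR THE V1 OPERATOR `∂P∂* = ∂(1 − R)∂*` OF THE GENUINE `k`-LEVEL GLOBAL TORUS — r03's `hDg`**: ONE `(M₃, δ₂, C)`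
(p21's (2.88)_T constants, functions of `d, L` only) such that for every V1 global torus (`hN`), every nested torus family `D` with `1 ≤ k` (LEVEL-0 JOINT J6),
`1 ≤ M_h`, `4 ≤ P′_μ`, `2L ≤ R`, `M₃ ≤ L·M_h`, `k ≤ m + K`, and every fine factor `c ≠ 0`:
`HasMajorant (blkV1 hN D) (onFun (∂_c(1 − R)∂_c*)) (c²(d+1)C·(L^j)^{−2}·e^{−δ₂d_T(y,y′)})`.
[cite: Balaban1984PropagatorsII, (2.88) p.238, (2.17) p.225] -/
theorem hasMajorant_Dg_V1 (d ℓ : ℕ) (hd : 1 ≤ d + 1) (hL : Odd (ℓ + 1) ∧ 1 < ℓ + 1) :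
    ∃ M₃ δ₂ C : ℝ, 0 < M₃ ∧ 0 < δ₂ ∧ 0 < C ∧
      ∀ (m K : ℕ) {Mh k R : ℕ} {P' : Fin (d + 1) → ℕ} (hN : ∀ μ, N0 ℓ Mh k P' μ = (PV d ℓ m K hd hL).sitesPerDir 0)
        (D : B6MultiLevelTorusOperatorL0.TDomains d ℓ Mh k P' R) (hk : k ≤ m + K), 1 ≤ k → 1 ≤ Mh → (∀ μ, 4 ≤ P' μ) → 2 * (ℓ + 1) ≤ R → M₃ ≤ ((ℓ : ℝ) + 1) * Mh →
        ∀ {c : ℝ}, c ≠ 0 →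
          HasMajorant (g := geomT D) (blkV1 hN D) (onFun (dE c ∘ₗ (LinearMap.id - RE (domT hN D hk) c) ∘ₗ dsE c))
            (fun y y' => c ^ 2 * ((d : ℝ) + 1) * C / (geomT D).len y ^ 2 * Real.exp (-(δ₂ * (geomT D).dist y y'))) := by
  have hℓ : 1 ≤ ℓ := by have := hL.2; omega
  obtain ⟨M₃, δ₂, C, hM₃, hδ₂, hC, h⟩ := ineq288_multiLevelTorus_chartShape d ℓ hℓ
  refine ⟨M₃, δ₂, C, hM₃, hδ₂, hC, fun m K Mh k R P' hN D hk hk1 hMh hP4 hR hM c hc => ?_⟩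
  have hP : ∀ μ, 1 ≤ P' μ := fun μ => le_trans (by norm_num) (hP4 μ)
  exact hasMajorant_Dg_chart hN D hk hc (rM D) (rM_transpose D hℓ hMh hP) (rM_range_fix D hℓ hMh hP).1
    (rM_range_fix D hℓ hMh hP).2 hC.le fun μ ν z z' => h k Mh R hk1 hM hR P' hP4 D μ ν z z'

/-- **THE SAME OVER B8's `geomTB D`** — the literal `hDg` binder of p38's `B6Ineq2134KFamKLevelTorusL0.h2134_kFam_torus`
(`blk := blkV1 hN D`, `CP := c²(d+1)C`, rate `δ₂`; `geomTB` and `geomT` have the same sites, lengths and distance).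
[cite: Balaban1984PropagatorsII, (2.88) p.238, (2.134) p.247] -/
theorem hasMajorant_Dg_V1_TB (d ℓ : ℕ) (hd : 1 ≤ d + 1) (hL : Odd (ℓ + 1) ∧ 1 < ℓ + 1) :
    ∃ M₃ δ₂ C : ℝ, 0 < M₃ ∧ 0 < δ₂ ∧ 0 < C ∧
      ∀ (m K : ℕ) {Mh k R : ℕ} {P' : Fin (d + 1) → ℕ} (hN : ∀ μ, N0 ℓ Mh k P' μ = (PV d ℓ m K hd hL).sitesPerDir 0)
        (D : B6MultiLevelTorusOperatorL0.TDomains d ℓ Mh k P' R) (hk : k ≤ m + K), 1 ≤ k → 1 ≤ Mh → (∀ μ, 4 ≤ P' μ) → 2 * (ℓ + 1) ≤ R → M₃ ≤ ((ℓ : ℝ) + 1) * Mh →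
        ∀ {c : ℝ}, c ≠ 0 →
          HasMajorant (g := geomTB D) (blkV1 hN D) (onFun (dE c ∘ₗ (LinearMap.id - RE (domT hN D hk) c) ∘ₗ dsE c))
            (fun y y' => c ^ 2 * ((d : ℝ) + 1) * C / (geomTB D).len y ^ 2 * Real.exp (-(δ₂ * (geomTB D).dist y y'))) := by
  obtain ⟨M₃, δ₂, C, hM₃, hδ₂, hC, h⟩ := hasMajorant_Dg_V1 d ℓ hd hL
  refine ⟨M₃, δ₂, C, hM₃, hδ₂, hC, fun m K Mh k R P' hN D hk hk1 hMh hP4 hR hM c hc => ?_⟩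
  intro y' μ B hB x
  have h1 := h m K hN D hk hk1 hMh hP4 hR hM hc y' μ B ⟨hB.nonneg, hB.bound, hB.off⟩ x
  simpa only [geomTB_dist, geomTB_len, geomT_len] using h1

end Majorant

end

end Literature.MathematicalPhysics.QuantumFieldTheory.Balaban1983to89.B6Dg288ChartV1L0
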